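import Summits.QuantumAdvantage.QuantumAdvantage.Theorems.OddPrimeWalkParallelepiped

/-!
# The three design frames: triples, simplex, doubled simplex (engine for item stmt-QuantumAdvantage-24031 `FarDegreePairLaw`)

Cell qa-qnc0, route OddPrimeWalk; prover qn-prover-3 g18 (design agreed with planner qa-qnc0-p2 g29, INBOX 03:53Z check (2)).

On a ground block of positions `[β, β + gLen d)`, `gLen d = 3(d+1) + 3·2^(d+1)`, three frames of `d+1` vectors each (`frame hn t`,
`t : Fin 3`) whose NON-EMPTY partial sums have weight `3|W|` (`t = 0`, disjoint triples), `2^d` (`t = 1`, the simplex frame: positions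
indexed by the patterns `{0,1}^(d+1)` through `Fintype.equivFinOfCardEq`, vector `j` = the `j`-th coordinate function, partial sum
over `W` = the parity pattern `par W`, and HALF OF ALL PATTERNS HAVE ODD PARITY on a non-empty `W` — `two_mul_card_par`, involution
flipping one coordinate of `W`) and `2^(d+1)` (`t = 2`, two disjoint copies of the simplex frame): `wt_fsum_frame_mod`.  The three
residues `0, 2^d, 2^(d+1)` are pairwise distinct mod `3`, so for every offset `c` exactly one frame lands in each residue class
(`card_frameRes_eq_one`).  §1 also collects generic tools: additivity of `extS`/`fsum`, weights of disjointly supported sums,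
interval blocks `ivl`.
WHAT THIS IS NOT: instrument; separation NOT moved.
-/

namespace Summit.QuantumAdvantage.AdviceFreeQNC0.OddConfig

open Finset Classical

variable {n D : ℕ}

/-! ### §1 Generic tools: additivity of `extS` and `fsum`, disjoint weights, interval blocks -/

/-- `extS` is additive. -/
theorem extS_addV (S : Finset (Fin n)) (g g' : Fin S.card → Bool) :
    extS S (addV g g') = addV (extS S g) (extS S g') := by
  funext i; by_cases h : i ∈ S <;> simp [extS, addV, h]

/-- `extS` of the zero vector. -/
theorem extS_zeroV (S : Finset (Fin n)) : extS S (zeroV (n := S.card)) = zeroV := by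
  funext i; by_cases h : i ∈ S <;> simp [extS, zeroV, h]

/-- partial sums commute with extension by zero. -/
theorem fsum_extS (S : Finset (Fin n)) (G : Fin D → Fin S.card → Bool) (W : Finset (Fin D)) :
    fsum (fun j => extS S (G j)) W = extS S (fsum G W) := by
  induction W using Finset.induction_on with
  | empty => rw [fsum_empty, fsum_empty, extS_zeroV]
  | insert j W hj ih => rw [fsum_insert _ hj, fsum_insert _ hj, ih, ← extS_addV]

/-- partial sums are additive in the frame. -/
theorem fsum_addV_frame (a b : Fin D → Fin n → Bool) (W : Finset (Fin D)) :
    fsum (fun j => addV (a j) (b j)) W = addV (fsum a W) (fsum b W) := by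
  induction W using Finset.induction_on with
  | empty => rw [fsum_empty, fsum_empty, fsum_empty, addV_zeroV]
  | insert j W hj ih =>
    rw [fsum_insert _ hj, fsum_insert _ hj, fsum_insert _ hj, ih]
    funext k; simp only [addV]; cases a j k <;> cases b j k <;> cases fsum a W k <;> cases fsum b W k <;> rfl

/-- partial sums of a `P`-supported frame are `P`-supported. -/
theorem fsum_supp {P : Fin n → Prop} (v : Fin D → Fin n → Bool) (hv : ∀ j k, v j k = true → P k)
    (W : Finset (Fin D)) : ∀ k, fsum v W k = true → P k := by
  intro k hk
  simp only [fsum, decide_eq_true_eq] at hk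
  have hne : (W.filter fun j => v j k = true).Nonempty := by
    apply nonempty_of_ne_empty; intro h; rw [h, card_empty] at hk; exact absurd hk (by norm_num)
  obtain ⟨j, hj⟩ := hne
  exact hv j k (mem_filter.mp hj).2

/-- weights add over disjointly supported vectors. -/
theorem wt_addV_of_disjoint (x y : Fin n → Bool) (h : ∀ i, ¬ (x i = true ∧ y i = true)) :
    wt (addV x y) = wt x + wt y := by
  unfold wt
  rw [← card_union_of_disjoint (disjoint_filter.mpr fun i _ hx hy => h i ⟨hx, hy⟩)]
  congr 1
  ext i
  simp only [mem_filter, mem_univ, true_and, mem_union, addV]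
  have hi := h i
  cases hx : x i <;> cases hy : y i <;> simp_all

/-- far weights add over disjointly supported vectors. -/
theorem wtB_addV_of_disjoint (m : ℕ) (x y : Fin n → Bool) (h : ∀ i, ¬ (x i = true ∧ y i = true)) :
    wtB m (addV x y) = wtB m x + wtB m y := by
  unfold wtB
  rw [← card_union_of_disjoint (disjoint_filter.mpr fun i _ hx hy => h i ⟨hx.2, hy.2⟩)]
  congr 1
  ext i
  simp only [mem_filter, mem_univ, true_and, mem_union, addV]
  have hi := h i
  cases hx : x i <;> cases hy : y i <;> simp_all

/-- near weights add over disjointly supported vectors. -/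
theorem wtA_addV_of_disjoint (m : ℕ) (x y : Fin n → Bool) (h : ∀ i, ¬ (x i = true ∧ y i = true)) :
    wtA m (addV x y) = wtA m x + wtA m y := by
  unfold wtA
  rw [← card_union_of_disjoint (disjoint_filter.mpr fun i _ hx hy => h i ⟨hx.2, hy.2⟩)]
  congr 1
  ext i
  simp only [mem_filter, mem_univ, true_and, mem_union, addV]
  have hi := h i
  cases hx : x i <;> cases hy : y i <;> simp_all

/-- the far weight of a far-supported vector is its weight. -/
theorem wtB_eq_wt_of_far (m : ℕ) (x : Fin n → Bool) (h : ∀ k, x k = true → m ≤ k.val) : wtB m x = wt x := by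
  unfold wtB wt; congr 1; ext i; simp only [mem_filter, mem_univ, true_and]
  constructor
  · exact fun h' => h'.2
  · exact fun h' => ⟨by have := h i h'; omega, h'⟩

/-- the near weight of a near-supported vector is its weight. -/
theorem wtA_eq_wt_of_near (m : ℕ) (x : Fin n → Bool) (h : ∀ k, x k = true → k.val < m) : wtA m x = wt x := by
  unfold wtA wt; congr 1; ext i; simp only [mem_filter, mem_univ, true_and]
  constructor
  · exact fun h' => h'.2
  · exact fun h' => ⟨h i h', h'⟩

/-- an interval block of positions. -/
def ivl (n a ℓ : ℕ) : Finset (Fin n) := univ.filter fun i : Fin n => a ≤ i.val ∧ i.val < a + ℓ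

/-- an interval block inside `[0, n)` has the expected size. -/
theorem card_ivl {a ℓ : ℕ} (h : a + ℓ ≤ n) : (ivl n a ℓ).card = ℓ := by
  have e : (ivl n a ℓ).card = (range ℓ).card := by
    refine card_bij' (fun i _ => i.val - a) (fun t ht => ⟨a + t, by have := mem_range.mp ht; omega⟩) ?_ ?_ ?_ ?_
    · intro i hi; have := (mem_filter.mp hi).2; exact mem_range.mpr (by omega)
    · intro t ht; have := mem_range.mp ht; exact mem_filter.mpr ⟨mem_univ _, by simp only; omega⟩
    · intro i hi; have := (mem_filter.mp hi).2; exact Fin.ext (by simp only; omega)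
    · intro t _; simp
  rw [e, card_range]

/-- the weight of an indicator vector is the size of the set. -/
theorem wt_indicator (T : Finset (Fin n)) : wt (fun i => decide (i ∈ T)) = T.card := by
  unfold wt; congr 1; ext i; simp

/-! ### §2 Parity patterns on `{0,1}^D` -/

/-- parity of a pattern `π` on the index set `W`. -/
def par (W : Finset (Fin D)) (π : Fin D → Bool) : Bool := decide ((W.filter fun j => π j = true).card % 2 = 1)

/-- flipping a coordinate inside `W` flips the parity. -/
theorem par_update_not (W : Finset (Fin D)) (π : Fin D → Bool) {j₀ : Fin D} (hj : j₀ ∈ W) :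
    par W (Function.update π j₀ (!π j₀)) = !par W π := by
  unfold par
  by_cases h0 : π j₀ = true
  · have e : (W.filter fun j => Function.update π j₀ (!π j₀) j = true) = (W.filter fun j => π j = true).erase j₀ := by
      ext j
      simp only [mem_filter, mem_erase]
      by_cases hj' : j = j₀
      · subst hj'; simp [h0]
      · rw [Function.update_of_ne hj']; tauto
    have hmem : j₀ ∈ W.filter fun j => π j = true := mem_filter.mpr ⟨hj, h0⟩
    rw [e, card_erase_of_mem hmem]
    have hpos : 1 ≤ (W.filter fun j => π j = true).card := card_pos.mpr ⟨j₀, hmem⟩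
    rcases Nat.mod_two_eq_zero_or_one (W.filter fun j => π j = true).card with h | h
    · have : ((W.filter fun j => π j = true).card - 1) % 2 = 1 := by omega
      simp [h, this]
    · have : ((W.filter fun j => π j = true).card - 1) % 2 = 0 := by omega
      simp [h, this]
  · have h0' : π j₀ = false := by simpa using h0
    have e : (W.filter fun j => Function.update π j₀ (!π j₀) j = true) = insert j₀ (W.filter fun j => π j = true) := by
      ext j
      simp only [mem_filter, mem_insert]
      by_cases hj' : j = j₀
      · subst hj'; simp [h0', hj]
      · rw [Function.update_of_ne hj']; tauto
    have hnot : j₀ ∉ W.filter fun j => π j = true := fun h => h0 (mem_filter.mp h).2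
    rw [e, card_insert_of_notMem hnot]
    rcases Nat.mod_two_eq_zero_or_one (W.filter fun j => π j = true).card with h | h
    · have : ((W.filter fun j => π j = true).card + 1) % 2 = 1 := by omega
      simp [h, this]
    · have : ((W.filter fun j => π j = true).card + 1) % 2 = 0 := by omega
      simp [h, this]

/-- **half of all patterns have odd parity on a non-empty `W`.** -/
theorem two_mul_card_par {W : Finset (Fin D)} (hW : W.Nonempty) :
    2 * (univ.filter fun π : Fin D → Bool => par W π = true).card = 2 ^ D := by
  obtain ⟨j₀, hj₀⟩ := hW
  have hφφ : ∀ π : Fin D → Bool, Function.update (Function.update π j₀ (!π j₀)) j₀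
      (!(Function.update π j₀ (!π j₀)) j₀) = π := by
    intro π; funext j; by_cases h : j = j₀
    · subst h; simp
    · simp [Function.update_of_ne h]
  have heq : (univ.filter fun π : Fin D → Bool => par W π = true).card
      = (univ.filter fun π : Fin D → Bool => ¬ par W π = true).card := by
    refine card_nbij' (fun π => Function.update π j₀ (!π j₀)) (fun π => Function.update π j₀ (!π j₀)) ?_ ?_ ?_ ?_
    · intro π hπ
      have h := (mem_filter.mp (mem_coe.mp hπ)).2
      rw [mem_coe, mem_filter, par_update_not W π hj₀, h]; simp
    · intro π hπ
      have h := (mem_filter.mp (mem_coe.mp hπ)).2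
      have h' : par W π = false := by simpa using h
      rw [mem_coe, mem_filter, par_update_not W π hj₀, h']; simp
    · intro π _; exact hφφ π
    · intro π _; exact hφφ π
  have htot := card_filter_add_card_filter_not (s := (univ : Finset (Fin D → Bool))) (fun π => par W π = true)
  rw [card_univ, Fintype.card_fun, Fintype.card_bool, Fintype.card_fin] at htot
  omega

/-- transport of the parity count through an equivalence `Fin N ≃ (Fin D → Bool)`. -/
theorem card_par_comp {N : ℕ} (E : Fin N ≃ (Fin D → Bool)) (W : Finset (Fin D)) :
    (univ.filter fun q : Fin N => par W (E q) = true).card = (univ.filter fun π : Fin D → Bool => par W π = true).card := by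
  refine card_nbij' E E.symm ?_ ?_ ?_ ?_
  · intro q hq; have := (mem_filter.mp (mem_coe.mp hq)).2; exact mem_coe.mpr (mem_filter.mpr ⟨mem_univ _, this⟩)
  · intro π hπ; have := (mem_filter.mp (mem_coe.mp hπ)).2
    exact mem_coe.mpr (mem_filter.mpr ⟨mem_univ _, by simpa using this⟩)
  · intro q _; simp
  · intro π _; simp

/-! ### §3 The three frames on a block of positions `[β, β + L)` -/

/-- the length of the ground block for degree `d`: `3(d+1) + 3·2^(d+1)`. -/
def gLen (d : ℕ) : ℕ := 3 * (d + 1) + 3 * 2 ^ (d + 1)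

section Frames

variable (n β d : ℕ)

/-- the simplex block. -/
def blkS : Finset (Fin n) := ivl n (β + 3 * (d + 1)) (2 ^ (d + 1))

/-- the first copy of the doubled simplex block. -/
def blkD1 : Finset (Fin n) := ivl n (β + 3 * (d + 1) + 2 ^ (d + 1)) (2 ^ (d + 1))

/-- the second copy of the doubled simplex block. -/
def blkD2 : Finset (Fin n) := ivl n (β + 3 * (d + 1) + 2 * 2 ^ (d + 1)) (2 ^ (d + 1))

variable {n β d}

/-- size of the simplex block. -/
theorem card_blkS (hn : β + gLen d ≤ n) : (blkS n β d).card = Fintype.card (Fin (d + 1) → Bool) := by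
  rw [Fintype.card_fun, Fintype.card_bool, Fintype.card_fin, blkS, card_ivl]; unfold gLen at hn; omega

/-- size of the first doubled block. -/
theorem card_blkD1 (hn : β + gLen d ≤ n) : (blkD1 n β d).card = Fintype.card (Fin (d + 1) → Bool) := by
  rw [Fintype.card_fun, Fintype.card_bool, Fintype.card_fin, blkD1, card_ivl]; unfold gLen at hn; omega

/-- size of the second doubled block. -/
theorem card_blkD2 (hn : β + gLen d ≤ n) : (blkD2 n β d).card = Fintype.card (Fin (d + 1) → Bool) := by
  rw [Fintype.card_fun, Fintype.card_bool, Fintype.card_fin, blkD2, card_ivl]; unfold gLen at hn; omega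

/-- patterns ↔ positions of the simplex block. -/
noncomputable def eqS (hn : β + gLen d ≤ n) : Fin (blkS n β d).card ≃ (Fin (d + 1) → Bool) :=
  (Fintype.equivFinOfCardEq (card_blkS hn).symm).symm

/-- patterns ↔ positions of the first doubled block. -/
noncomputable def eqD1 (hn : β + gLen d ≤ n) : Fin (blkD1 n β d).card ≃ (Fin (d + 1) → Bool) :=
  (Fintype.equivFinOfCardEq (card_blkD1 hn).symm).symm

/-- patterns ↔ positions of the second doubled block. -/
noncomputable def eqD2 (hn : β + gLen d ≤ n) : Fin (blkD2 n β d).card ≃ (Fin (d + 1) → Bool) :=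
  (Fintype.equivFinOfCardEq (card_blkD2 hn).symm).symm

/-- **the three frames**: `t = 0` disjoint triples (partial sums weigh `3|W|`), `t = 1` the simplex frame (partial sums weigh
`2^d`), `t = 2` the doubled simplex frame (partial sums weigh `2^(d+1)`). -/
noncomputable def frame (hn : β + gLen d ≤ n) (t : Fin 3) (j : Fin (d + 1)) : Fin n → Bool :=
  if t = 0 then fun i => decide (i ∈ ivl n (β + 3 * j.val) 3)
  else if t = 1 then extS (blkS n β d) (fun q => eqS hn q j)
  else addV (extS (blkD1 n β d) (fun q => eqD1 hn q j)) (extS (blkD2 n β d) (fun q => eqD2 hn q j))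

/-- the frames are supported in the ground block `[β, β + gLen d)`. -/
theorem frame_supp (hn : β + gLen d ≤ n) (t : Fin 3) (j : Fin (d + 1)) (k : Fin n)
    (hk : frame hn t j k = true) : β ≤ k.val ∧ k.val < β + gLen d := by
  unfold frame at hk
  have hj := j.isLt
  unfold gLen
  split_ifs at hk with h0 h1
  · simp only [ivl, mem_filter, mem_univ, true_and, decide_eq_true_eq] at hk; omega
  · have hkS : k ∈ blkS n β d := by by_contra h; rw [extS_apply_not_mem _ h] at hk; exact Bool.false_ne_true hk
    simp only [blkS, ivl, mem_filter, mem_univ, true_and] at hkS; omega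
  · by_cases hk1 : k ∈ blkD1 n β d
    · simp only [blkD1, ivl, mem_filter, mem_univ, true_and] at hk1; omega
    · by_cases hk2 : k ∈ blkD2 n β d
      · simp only [blkD2, ivl, mem_filter, mem_univ, true_and] at hk2; omega
      · simp [addV, extS_apply_not_mem _ hk1, extS_apply_not_mem _ hk2] at hk

/-- partial sums of the triple frame are indicators of unions of triples. -/
theorem fsum_frame_zero (hn : β + gLen d ≤ n) (W : Finset (Fin (d + 1))) :
    fsum (frame hn 0) W = fun i => decide (i ∈ W.biUnion fun j => ivl n (β + 3 * j.val) 3) := by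
  funext i
  have hf : ∀ j, frame hn 0 j i = decide (i ∈ ivl n (β + 3 * j.val) 3) := fun j => by simp [frame]
  simp only [fsum, hf, decide_eq_true_eq, mem_biUnion]
  have hsub : ∀ j₁ ∈ W.filter (fun j => i ∈ ivl n (β + 3 * j.val) 3), ∀ j₂ ∈ W.filter (fun j => i ∈ ivl n (β + 3 * j.val) 3),
      j₁ = j₂ := by
    intro j₁ h₁ j₂ h₂
    have a := (mem_filter.mp h₁).2; have b := (mem_filter.mp h₂).2
    simp only [ivl, mem_filter, mem_univ, true_and] at a b
    exact Fin.ext (by omega)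
  have hle : (W.filter fun j => i ∈ ivl n (β + 3 * j.val) 3).card ≤ 1 := card_le_one.mpr hsub
  by_cases hex : ∃ j ∈ W, i ∈ ivl n (β + 3 * j.val) 3
  · have hex' := hex
    obtain ⟨j, hjW, hji⟩ := hex'
    have hpos : 0 < (W.filter fun j => i ∈ ivl n (β + 3 * j.val) 3).card :=
      card_pos.mpr ⟨j, mem_filter.mpr ⟨hjW, hji⟩⟩
    have h1 : (W.filter fun j => i ∈ ivl n (β + 3 * j.val) 3).card = 1 := by omega
    rw [h1, decide_eq_true hex]; rfl
  · have h0 : (W.filter fun j => i ∈ ivl n (β + 3 * j.val) 3).card = 0 := by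
      rw [card_eq_zero]; ext j; simp only [mem_filter, notMem_empty, iff_false, not_and]
      exact fun hj hi => hex ⟨j, hj, hi⟩
    rw [h0, decide_eq_false hex]; rfl

/-- **weights of the triple frame**: `|fsum (frame 0) W| = 3|W|`. -/
theorem wt_fsum_frame_zero (hn : β + gLen d ≤ n) (W : Finset (Fin (d + 1))) : wt (fsum (frame hn 0) W) = 3 * W.card := by
  rw [fsum_frame_zero hn W, wt_indicator, card_biUnion]
  · rw [sum_congr rfl (fun j _ => card_ivl (show β + 3 * j.val + 3 ≤ n by
      have := j.isLt; unfold gLen at hn; omega)), sum_const, smul_eq_mul, mul_comm]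
  · intro j₁ _ j₂ _ hne
    rw [Function.onFun, ivl, ivl, disjoint_filter]
    intro i _ h1 h2
    exact hne (Fin.ext (by omega))

/-- weight of a partial sum of an extended pattern frame. -/
theorem wt_fsum_extS_pattern {S : Finset (Fin n)} (E : Fin S.card ≃ (Fin (d + 1) → Bool))
    {W : Finset (Fin (d + 1))} (hW : W.Nonempty) :
    wt (fsum (fun j => extS S (fun q => E q j)) W) = 2 ^ d := by
  rw [fsum_extS, wt_extS]
  have e : wt (fsum (fun j q => E q j) W) = (univ.filter fun q : Fin S.card => par W (E q) = true).card := by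
    unfold wt; congr 1
  rw [e, card_par_comp E W]
  have h := two_mul_card_par hW
  rw [pow_succ] at h
  omega

/-- **weights of the simplex frame**: `|fsum (frame 1) W| = 2^d` for `W ≠ ∅`. -/
theorem wt_fsum_frame_one (hn : β + gLen d ≤ n) {W : Finset (Fin (d + 1))} (hW : W.Nonempty) :
    wt (fsum (frame hn 1) W) = 2 ^ d := by
  have hf : frame hn 1 = fun j => extS (blkS n β d) (fun q => eqS hn q j) := by funext j; simp [frame]
  rw [hf]; exact wt_fsum_extS_pattern (eqS hn) hW

/-- **weights of the doubled simplex frame**: `|fsum (frame 2) W| = 2^(d+1)` for `W ≠ ∅`. -/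
theorem wt_fsum_frame_two (hn : β + gLen d ≤ n) {W : Finset (Fin (d + 1))} (hW : W.Nonempty) :
    wt (fsum (frame hn 2) W) = 2 ^ (d + 1) := by
  have hf : frame hn 2 = fun j => addV (extS (blkD1 n β d) (fun q => eqD1 hn q j))
      (extS (blkD2 n β d) (fun q => eqD2 hn q j)) := by
    funext j; simp [frame]
  rw [hf, fsum_addV_frame, wt_addV_of_disjoint, wt_fsum_extS_pattern (eqD1 hn) hW, wt_fsum_extS_pattern (eqD2 hn) hW,
    pow_succ]
  · ring
  · intro i ⟨h1, h2⟩
    rw [fsum_extS] at h1 h2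
    have hi1 : i ∈ blkD1 n β d := by by_contra h; rw [extS_apply_not_mem _ h] at h1; exact Bool.false_ne_true h1
    have hi2 : i ∈ blkD2 n β d := by by_contra h; rw [extS_apply_not_mem _ h] at h2; exact Bool.false_ne_true h2
    simp only [blkD1, blkD2, ivl, mem_filter, mem_univ, true_and] at hi1 hi2
    omega

/-- the residues of the three frames: `0`, `2^d`, `2^(d+1)` (mod 3). -/
def frameRes (d : ℕ) (t : Fin 3) : ℕ := if t = 0 then 0 else if t = 1 then 2 ^ d else 2 ^ (d + 1)

/-- **weights of partial sums, all three frames, mod 3.** -/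
theorem wt_fsum_frame_mod (hn : β + gLen d ≤ n) (t : Fin 3) {W : Finset (Fin (d + 1))} (hW : W.Nonempty) :
    wt (fsum (frame hn t) W) % 3 = frameRes d t % 3 := by
  have ht : t = 0 ∨ t = 1 ∨ t = 2 := by fin_cases t <;> simp
  rcases ht with rfl | rfl | rfl
  · rw [wt_fsum_frame_zero hn W]; simp [frameRes, Nat.mul_mod_right]
  · rw [wt_fsum_frame_one hn hW]; simp [frameRes]
  · rw [wt_fsum_frame_two hn hW]; simp [frameRes]

/-- for every offset `c`, exactly one frame lands in each residue class. -/
theorem card_frameRes_eq_one (d c : ℕ) {b : ℕ} (hb : b < 3) :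
    (univ.filter fun t : Fin 3 => (c + frameRes d t) % 3 = b).card = 1 := by
  have h2gen : ∀ e : ℕ, 2 ^ e % 3 = 1 ∨ 2 ^ e % 3 = 2 := by
    intro e
    induction e with
    | zero => left; rfl
    | succ k ih => rw [pow_succ]; omega
  have h2 := h2gen d
  have hsucc : 2 ^ (d + 1) % 3 = (2 * (2 ^ d % 3)) % 3 := by rw [pow_succ]; omega
  have e : ∀ t : Fin 3, ((c + frameRes d t) % 3 = b) ↔
      ((c % 3 + (if t = 0 then 0 else if t = 1 then 2 ^ d % 3 else 2 ^ (d + 1) % 3)) % 3 = b) := by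
    intro t; unfold frameRes; split_ifs <;> omega
  have e' : (univ.filter fun t : Fin 3 => (c + frameRes d t) % 3 = b) = univ.filter fun t : Fin 3 =>
      ((c % 3 + (if t = 0 then 0 else if t = 1 then 2 ^ d % 3 else 2 ^ (d + 1) % 3)) % 3 = b) :=
    filter_congr fun t _ => e t
  rw [e', hsucc]
  generalize hx : 2 ^ d % 3 = x at h2 ⊢
  have hc : c % 3 < 3 := Nat.mod_lt _ (by norm_num)
  generalize hc' : c % 3 = c' at hc ⊢
  interval_cases c' <;> interval_cases b <;> rcases h2 with rfl | rfl <;> decide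

end Frames

end Summit.QuantumAdvantage.AdviceFreeQNC0.OddConfig
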